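import Summits.ResolutionOfSingularities.ResolutionOfSingularities.Theorems.MarkedTransferCampaignW46CurveDeltaInvariant
import Summits.ResolutionOfSingularities.ResolutionOfSingularities.Theorems.MarkedTransferCampaignW46FiniteExitBound
import HarnessLib

/-!
# [OURS · L1 W4.6 rung (i-h)] THE LENGTH OF PHASE 0: along a finite run of OUR procedure on a surface, the stages before
# every singular curve is regular number at most `Δ(E₀)` (cell res-hironaka, LADDER-RESOLUTION rung L, D-0089; campaign
# s46, prover res-L1-s46-pv-1; host route MarkedTransfer, `--supports stmt-ResolutionOfSingularities-16155`)

HONEST FRAMING. Nothing here is a statement of H. Hironaka's manuscript (2017-03-23, [Hironaka2017]) and nothing here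
asserts that any statement of it holds. OURS bookkeeping over the state function `Δ` (`curveDelta`, p545510) along the
campaign's FINITE sequence type `FinPermissibleRun` (p485314). AI-written; weaker than expert review. No `sorry`; axioms
standard.

## What (numbers, not adjectives)

* `FinPermissibleRun.curveDelta_add_card_le` — along a finite §2.1-permissible sequence with surface stages (any field,
  any universe), `Δ(E_N) + #{k < N | step k is a good procrastination} ≤ Δ(E₀)` for every `N ≤ len`;
* `FinPermissibleRun.card_goodProcrastinations_le` — hence at most `Δ(E₀)` of its steps are good procrastinations;
* **`FinPermissibleRun.phaseZero_length_le`** — along a finite run of OUR procedure (`OurCentre` at every step), if the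
  first `m` stages are NOT in the class «singular curves regular», then `m ≤ Δ(E₀)`: PHASE 0 takes at most `Δ(E₀)`
  blow-ups, after which (by `singCurvesRegular_transform`, p535455) the honest procedure of rung (i-g) runs.

## References

* J. Kollár, Lectures on Resolution of Singularities (2007), §1.4. [Kollar2007]
* H. Hironaka, ms. 2017-03-23, Th. 16.13 p.87 l.26–28 — scope only, under adjudication, not cited as fact. [Hironaka2017]
-/

noncomputable section

set_option linter.dupNamespace false -- mandated namespace of this single-conjunct summit

open CategoryTheory AlgebraicGeometry TopologicalSpace

namespace Summit.ResolutionOfSingularities.ResolutionOfSingularities.Theorems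

namespace CampaignW46

open Literature.AlgebraicGeometry.Resolution
open Literature.AlgebraicGeometry.Hironaka2017.S02Preliminaries
open Literature.AlgebraicGeometry.Hironaka2017.Datum
open Scheme.IdealSheafData

universe u

variable {p : ℕ} [Fact p.Prime] {K : Type u} [Field K] [CharP K p]

namespace FinPermissibleRun

/-- **The budget invariant along a finite sequence**: `Δ(E_N) + #{k < N | good procrastination at k} ≤ Δ(E₀)` for
`N ≤ len`. [cite: Kollar2007, §1.4] -/
theorem curveDelta_add_card_le (r : FinPermissibleRun p K) (hdim : ∀ k, k ≤ r.len → Regime.dimLE 2 (r.A k) (r.E k))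
    (s : Finset ℕ) (hs : ∀ k ∈ s, k < r.len ∧ CentreGoodProcrastination (r.E k) (r.D k)) :
    ∀ N, N ≤ r.len →
      curveDelta (r.A N).Z (r.E N).J + ((s.filter (· < N)).card : ℕ∞) ≤ curveDelta (r.A 0).Z (r.E 0).J := by
  intro N
  induction N with
  | zero =>
    intro _
    have h0 : s.filter (· < 0) = ∅ := Finset.filter_false_of_mem fun k _ => Nat.not_lt_zero k
    rw [h0, Finset.card_empty, Nat.cast_zero, add_zero]
  | succ N ih =>
    intro hN1
    have hN : N < r.len := Nat.lt_of_succ_le hN1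
    have ih' := ih hN.le
    have hsplit : s.filter (· < N + 1) = s.filter (· < N) ∪ s.filter (· = N) := by
      ext k
      simp only [Finset.mem_filter, Finset.mem_union]
      constructor
      · rintro ⟨hk, hlt⟩
        rcases Nat.lt_succ_iff_lt_or_eq.mp hlt with h | h
        · exact Or.inl ⟨hk, h⟩
        · exact Or.inr ⟨hk, h⟩
      · rintro (⟨hk, h⟩ | ⟨hk, h⟩)
        · exact ⟨hk, Nat.lt_succ_of_lt h⟩
        · exact ⟨hk, h ▸ Nat.lt_succ_self N⟩
    have hdisj : Disjoint (s.filter (· < N)) (s.filter (· = N)) := by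
      rw [Finset.disjoint_filter]
      intro k _ hlt heq
      exact absurd heq (Nat.ne_of_lt hlt)
    have hstep : curveDelta (r.A (N + 1)).Z (r.E (N + 1)).J ≤ curveDelta (r.A N).Z (r.E N).J := by
      rw [r.E_succ N hN]
      exact curveDelta_transform_le (r.A N) (r.A (N + 1)) (r.E N) (r.standard N hN.le) (hdim N hN.le)
        (r.permissible N hN) (r.blowup N hN)
    by_cases hNs : N ∈ s
    · have hlt : curveDelta (r.A (N + 1)).Z (r.E (N + 1)).J < curveDelta (r.A N).Z (r.E N).J := by
        rw [r.E_succ N hN]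
        exact curveDelta_transform_lt_of_good (r.A N) (r.A (N + 1)) (r.E N) (r.standard N hN.le) (hdim N hN.le)
          (hs N hNs).2 (r.blowup N hN)
      have hone : s.filter (· = N) = {N} := by
        ext k
        simp only [Finset.mem_filter, Finset.mem_singleton]
        exact ⟨fun h => h.2, fun h => ⟨h ▸ hNs, h⟩⟩
      rw [hsplit, Finset.card_union_of_disjoint hdisj, hone, Finset.card_singleton, Nat.cast_add, Nat.cast_one,
        ← add_assoc, add_right_comm]
      exact le_trans (add_le_add (Order.add_one_le_of_lt hlt) le_rfl) ih'
    · have hnone : s.filter (· = N) = ∅ := Finset.filter_false_of_mem fun k hk h => hNs (h ▸ hk)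
      rw [hsplit, hnone, Finset.union_empty]
      exact le_trans (add_le_add hstep le_rfl) ih'

/-- [OURS · L1 W4.6 rung (i-h)] NOT a statement of the manuscript. **At most `Δ(E₀)` steps of a finite §2.1-permissible
surface sequence are good procrastinations** (any field). [cite: Kollar2007, §1.4] -/
theorem card_goodProcrastinations_le (r : FinPermissibleRun p K)
    (hdim : ∀ k, k ≤ r.len → Regime.dimLE 2 (r.A k) (r.E k)) (s : Finset ℕ)
    (hs : ∀ k ∈ s, k < r.len ∧ CentreGoodProcrastination (r.E k) (r.D k)) :
    (s.card : ℕ∞) ≤ curveDelta (r.A 0).Z (r.E 0).J := by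
  have h := r.curveDelta_add_card_le hdim s hs r.len le_rfl
  have hall : s.filter (· < r.len) = s := Finset.filter_true_of_mem fun k hk => (hs k hk).1
  rw [hall] at h
  exact le_trans le_add_self h

/-- [OURS · L1 W4.6 rung (i-h)] NOT a statement of the manuscript. **PHASE 0 OF OUR PROCEDURE TAKES AT MOST `Δ(E₀)`
BLOW-UPS.** Along a finite §2.1-permissible surface sequence obeying OUR centre rule (`OurCentre` at every step; any
field), if none of the first `m ≤ len` stages is in the class «singular curves regular», then `m ≤ Δ(E₀)` — every one of
those `m` steps is forced to be a good procrastination, and each lowers `Δ`. [cite: Kollar2007, §1.4] -/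
theorem phaseZero_length_le (r : FinPermissibleRun p K) (hdim : ∀ k, k ≤ r.len → Regime.dimLE 2 (r.A k) (r.E k))
    (hour : ∀ k, k < r.len → OurCentre (r.A k) (r.E k) (r.D k)) {m : ℕ} (hm : m ≤ r.len)
    (hnot : ∀ k, k < m → ¬ Regime.singCurvesRegular (r.A k) (r.E k)) :
    (m : ℕ∞) ≤ curveDelta (r.A 0).Z (r.E 0).J := by
  have hgood : ∀ k ∈ Finset.range m, k < r.len ∧ CentreGoodProcrastination (r.E k) (r.D k) := by
    intro k hk
    have hkm : k < m := Finset.mem_range.mp hk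
    have hkl : k < r.len := lt_of_lt_of_le hkm hm
    refine ⟨hkl, ?_⟩
    rcases hour k hkl with hg | ⟨hP, -⟩
    · exact hg
    · exact absurd hP (hnot k hkm)
  have h := r.card_goodProcrastinations_le hdim (Finset.range m) hgood
  rwa [Finset.card_range] at h

end FinPermissibleRun

end CampaignW46

end Summit.ResolutionOfSingularities.ResolutionOfSingularities.Theorems

end
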